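import Mathlib.RingTheory.Norm.Transitivity
import Mathlib.Algebra.Polynomial.Bivariate
import Literature.NumberTheory.GaloisRepresentations.SuperellipticPicDivisible
import Literature.NumberTheory.GaloisRepresentations.SuperellipticPointPlaces
import HarnessLib

/-!
# Polynomials `u(X, Y)` evaluated on the superelliptic function field `Λ(C_f)`

Elementary algebra of the affine coordinate ring of `C_f : y^p = f(x)` used by the explicit (Deuring) reduction of
divisors of `K̄(C_f)` modulo a prime of `ℤ̄` (`SuperellipticReduction`): for a ring `R` with a map `φ : R → Λ` and a
model `f_R ∈ R[X]` of `f` (`f_R^φ = f`),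

* `SuperellipticFunctionField.polyEval k p f φ : R[X][Y] →+* Λ(C_f)`, `u ↦ u^φ(x, y)`; its kernel contains
  `(Y^p - f_R)` and equals it when `φ` is injective (`polyEval_eq_zero_iff`, the basis `1, y, …, y^{p-1}`);
* values at points: `u(x, y) ≡ φ(u(a, b)) (mod Q_{(a,b)})` at the place of a point `(φ a, φ b)`
  (`valuation_polyEval_sub_lt_one`), hence `v_Q(u(x,y)) = 0 ↔ φ(u(a,b)) ≠ 0` (`ord_polyEval_eq_zero_iff`);
* the **division lemma** `exists_mul_geomSum_eq`: `u(a,b) = 0`, `b^p = f_R(a)` ⟹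
  `u · E_b = (X - a) u' + (Y^p - f_R) q` with `E_b(a', b) = p b^{p-1}`;
* the **norm form** `modelNorm p f_R u = N_{R[X][Y]/(Y^p-f_R) / R[X]}(u) ∈ R[X]`, computing `N_{Λ(C_f)/Λ(x)}(u(x,y))`
  (`norm_polyEval`, via `norm_map_of_basis`), and the **fibre-sum formula**
  `∑_{Q | P_a} v_Q(z) = v_{P_a}(N(z))` (`sum_ord_fibre_eq_ord_norm`, Stichtenoth Thm. 3.1.11 made explicit for the
  cyclic cover `Λ(C_f)/Λ(x)`: the norm is `∏ δ^i z` over the deck group).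

## References
* [cite: Stichtenoth2009, Thm. 3.1.11, Prop. 1.2.1]
-/

noncomputable section

open Polynomial
open scoped Classical Polynomial.Bivariate

namespace Literature.NumberTheory.GaloisRepresentations

open Literature.NumberTheory.DiophantineGeometry Literature.NumberTheory.DiophantineGeometry.AlgFunctionField

universe u v w

/-! ### Norms along a map of free algebras with matching bases -/

/-- **Norms commute with maps of algebras matching chosen bases**: if `ψ : S → S'` lies over `φ : R → R'` and maps
the `R`-basis `b` of `S` to the `R'`-basis `b'` of `S'`, then `φ (N_{S/R} x) = N_{S'/R'} (ψ x)` (both norms are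
determinants of left-multiplication matrices, whose entries are coordinates). [folklore] -/
theorem norm_map_of_basis {R S R' S' ι : Type*} [CommRing R] [CommRing S] [Algebra R S] [CommRing R'] [CommRing S']
    [Algebra R' S'] [Fintype ι] [DecidableEq ι] (b : Module.Basis ι R S) (b' : Module.Basis ι R' S') (φ : R →+* R')
    (ψ : S →+* S') (halg : ∀ r, ψ (algebraMap R S r) = algebraMap R' S' (φ r)) (hb : ∀ i, ψ (b i) = b' i) (x : S) :
    φ (Algebra.norm R x) = Algebra.norm R' (ψ x) := by
  have hrepr : ∀ y : S, ∀ i, b'.repr (ψ y) i = φ (b.repr y i) := by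
    intro y i
    have hy : ψ y = ∑ j, φ (b.repr y j) • b' j := by
      conv_lhs => rw [← b.sum_repr y]
      rw [map_sum]
      refine Finset.sum_congr rfl fun j _ => ?_
      rw [Algebra.smul_def, Algebra.smul_def, map_mul, halg, hb]
    rw [hy, b'.repr_sum_self]
  rw [Algebra.norm_eq_matrix_det b, Algebra.norm_eq_matrix_det b', RingHom.map_det]
  congr 1
  ext i j
  rw [RingHom.mapMatrix_apply, Matrix.map_apply, Algebra.leftMulMatrix_eq_repr_mul, Algebra.leftMulMatrix_eq_repr_mul,
    ← hb j, ← map_mul ψ, hrepr]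

namespace SuperellipticFunctionField

variable {k : Type u} [Field k] {Λ : Type v} [Field Λ] [Algebra k Λ] {p : ℕ} {f : k[X]}
variable [Fact (Irreducible (superellipticPoly k Λ p f))]
variable {R : Type w} [CommRing R] (φ : R →+* Λ)

/-! ### Evaluating `R[X][Y]` in `Λ(C_f)` along `φ : R → Λ` -/

/-- The coefficient map `R[X] → Λ(x)`, `q ↦ q^φ(x)`. [folklore] -/
def coeffHom : R[X] →+* RatFunc Λ :=
  (algebraMap Λ[X] (RatFunc Λ)).comp (mapRingHom φ)

/-- `coeffHom φ q = q^φ(x) ∈ Λ(x)`. [folklore] -/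
theorem coeffHom_apply (q : R[X]) : coeffHom φ q = algebraMap Λ[X] (RatFunc Λ) (q.map φ) := rfl

/-- `coeffHom φ` is injective for `φ` injective. [folklore] -/
theorem coeffHom_injective (hφ : Function.Injective φ) : Function.Injective (coeffHom (Λ := Λ) φ) :=
  (IsFractionRing.injective Λ[X] (RatFunc Λ)).comp (Polynomial.map_injective φ hφ)

variable (k p f) in
/-- **Evaluation `u(x, y) ∈ Λ(C_f)` of a polynomial `u ∈ R[X][Y]`** along `φ : R → Λ`: map the coefficients by `φ`,
substitute `x` for `X` and `y` for `Y` (as a ring homomorphism `R[X][Y] → Λ(x)[Y] → Λ(x)[Y]/(Y^p - f) = Λ(C_f)`).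
Used with `R = ℤ̄_𝔓`, `φ` the inclusion into `K̄` (generic fibre) or the residue map to `κ(𝔓)` (special fibre). [folklore] -/
def polyEval : R[X][Y] →+* SuperellipticFunctionField k Λ p f :=
  (AdjoinRoot.mk (superellipticPoly k Λ p f)).comp (mapRingHom (coeffHom φ))

/-- `polyEval φ u = [u^φ] ∈ Λ(x)[Y]/(Y^p - f)`. [folklore] -/
theorem polyEval_apply (u : R[X][Y]) :
    polyEval k p f φ u = AdjoinRoot.mk (superellipticPoly k Λ p f) (u.map (coeffHom φ)) := rfl

/-- `polyEval` on `Y` is `y`. [folklore] -/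
@[simp]
theorem polyEval_X : polyEval k p f φ (X : R[X][Y]) = genY k Λ p f := by
  rw [polyEval_apply, Polynomial.map_X, AdjoinRoot.mk_X]; rfl

/-- `polyEval` on a coefficient `q ∈ R[X]` is `q^φ(x)`. [folklore] -/
theorem polyEval_C (q : R[X]) :
    polyEval k p f φ (C q) = algebraMap (RatFunc Λ) (SuperellipticFunctionField k Λ p f) (coeffHom φ q) := by
  rw [polyEval_apply, Polynomial.map_C, AdjoinRoot.mk_C, AdjoinRoot.algebraMap_eq]

/-- `polyEval` on a coefficient `q ∈ R[X]` is `q^φ(x) = aeval x q^φ`. [folklore] -/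
theorem polyEval_C_eq_aeval (q : R[X]) : polyEval k p f φ (C q) = aeval (genX k Λ p f) (q.map φ) := by
  rw [polyEval_C, coeffHom_apply, ← IsScalarTower.algebraMap_apply, aeval_genX]

/-- `polyEval` on a constant `r` is the constant `φ r`. [folklore] -/
@[simp]
theorem polyEval_C_C (r : R) :
    polyEval k p f φ (C (C r)) = algebraMap Λ (SuperellipticFunctionField k Λ p f) (φ r) := by
  rw [polyEval_C_eq_aeval, map_C, aeval_C]

/-- `polyEval` on `X` (the inner variable) is `x`. [folklore] -/
@[simp]
theorem polyEval_C_X : polyEval k p f φ (C X : R[X][Y]) = genX k Λ p f := by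
  rw [polyEval_C_eq_aeval, Polynomial.map_X, aeval_X]

/-- `polyEval (C (X - C a)) = x - φ a`. [folklore] -/
theorem polyEval_C_X_sub_C (a : R) :
    polyEval k p f φ (C (X - C a) : R[X][Y]) = genX k Λ p f - algebraMap Λ _ (φ a) := by
  rw [map_sub, map_sub, polyEval_C_X, polyEval_C_C]

/-! ### The integral model `Y^p - f_R` of the curve -/

section Model

variable {fR : R[X]} (hf : fR.map φ = f.map (algebraMap k Λ))
include hf

omit [Fact (Irreducible (superellipticPoly k Λ p f))] in
/-- The model `Y^p - f_R` maps to the defining polynomial `Y^p - f(x)` of `Λ(C_f)`. [folklore] -/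
theorem map_model : ((X : R[X][Y]) ^ p - C fR).map (coeffHom φ) = superellipticPoly k Λ p f := by
  rw [Polynomial.map_sub, Polynomial.map_pow, Polynomial.map_X, Polynomial.map_C, coeffHom_apply, hf]; rfl

/-- **`Y^p - f_R` evaluates to `0`** (`y^p = f(x)`). [folklore] -/
theorem polyEval_model : polyEval k p f φ ((X : R[X][Y]) ^ p - C fR) = 0 := by
  rw [polyEval_apply, map_model φ hf, AdjoinRoot.mk_self]

/-- Multiples of `Y^p - f_R` evaluate to `0`. [folklore] -/
theorem polyEval_eq_zero_of_dvd {u : R[X][Y]} (hu : (X : R[X][Y]) ^ p - C fR ∣ u) : polyEval k p f φ u = 0 := by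
  obtain ⟨q, rfl⟩ := hu
  rw [map_mul, polyEval_model φ hf, zero_mul]

/-- **The kernel of evaluation along an injective `φ`** is generated by `Y^p - f_R`: reduce `u` modulo the monic
`Y^p - f_R`; a remainder of `Y`-degree `< p` that vanishes at `y` is `0` by the power basis `1, y, …, y^{p-1}` of
`Λ(C_f)/Λ(x)`. [folklore] -/
theorem polyEval_eq_zero_iff (hφ : Function.Injective φ) (hp : p ≠ 0) (u : R[X][Y]) :
    polyEval k p f φ u = 0 ↔ (X : R[X][Y]) ^ p - C fR ∣ u := by
  refine ⟨fun h => ?_, polyEval_eq_zero_of_dvd φ hf⟩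
  haveI : Nontrivial R := ⟨⟨0, 1, fun h01 => zero_ne_one ((map_zero φ).symm.trans ((congrArg φ h01).trans (map_one φ)))⟩⟩
  set g : R[X][Y] := (X : R[X][Y]) ^ p - C fR with hg
  have hgm : g.Monic := monic_X_pow_sub_C _ hp
  have hinj : Function.Injective (mapRingHom (coeffHom (Λ := Λ) φ)) := Polynomial.map_injective _ (coeffHom_injective φ hφ)
  rw [polyEval_apply, AdjoinRoot.mk_eq_zero, ← map_model φ hf] at h
  -- `u = g q + r`
  have hdecomp : u %ₘ g + g * (u /ₘ g) = u := modByMonic_add_div u g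
  have hr : (mapRingHom (coeffHom (Λ := Λ) φ)) g ∣ (u %ₘ g).map (coeffHom φ) := by
    have h1 : (u %ₘ g).map (coeffHom φ) = u.map (coeffHom φ) - g.map (coeffHom φ) * (u /ₘ g).map (coeffHom φ) := by
      refine eq_sub_of_add_eq ?_
      rw [← Polynomial.map_mul, ← Polynomial.map_add, hdecomp]
    rw [h1]
    exact dvd_sub h (dvd_mul_right _ _)
  have hdeg : ((u %ₘ g).map (coeffHom (Λ := Λ) φ)).degree < ((mapRingHom (coeffHom (Λ := Λ) φ)) g).degree := by
    rw [coe_mapRingHom, hgm.degree_map]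
    exact (degree_map_le).trans_lt (degree_modByMonic_lt u hgm)
  have hr0 : (u %ₘ g).map (coeffHom (Λ := Λ) φ) = 0 := eq_zero_of_dvd_of_degree_lt hr hdeg
  have hr0' : u %ₘ g = 0 := hinj (by rw [coe_mapRingHom, hr0, Polynomial.map_zero])
  rw [← hdecomp, hr0', zero_add]
  exact dvd_mul_right _ _

end Model

/-! ### Values at the points of the curve -/

section Values

variable [hp : Fact p.Prime] [IsAlgClosed Λ] {ζ₀ : Λ} (hζ₀ : IsPrimitiveRoot ζ₀ p) (hsep : f.Separable)
include hζ₀ hsep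

/-- **`u(x, y) ∈ O_Q` at the place `Q` of a point**: `x, y` and the constants are integral there. [folklore] -/
theorem polyEval_mem_pointPlace {a b : R} (hb : φ b ^ p = (f.map (algebraMap k Λ)).eval (φ a)) (u : R[X][Y]) :
    polyEval k p f φ u ∈ (pointPlace k Λ p f (φ a) (φ b)).toValuationSubring := by
  rw [polyEval_apply, ← AdjoinRoot.aeval_eq, aeval_eq_sum_range]
  refine Subring.sum_mem _ fun i _ => ?_
  rw [coeff_map, Algebra.smul_def, AdjoinRoot.algebraMap_eq, ← AdjoinRoot.mk_C, ← Polynomial.map_C, ← polyEval_apply,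
    polyEval_C_eq_aeval]
  exact mul_mem (aeval_genX_mem_pointPlace hζ₀ hsep hb _) (pow_mem (genY_mem_pointPlace hζ₀ hsep hb) _)

/-- `v_Q(u(x,y)) ≤ 1` at the place of a point. [folklore] -/
theorem valuation_polyEval_le_one {a b : R} (hb : φ b ^ p = (f.map (algebraMap k Λ)).eval (φ a)) (u : R[X][Y]) :
    (pointPlace k Λ p f (φ a) (φ b)).valuation (polyEval k p f φ u) ≤ 1 :=
  ((pointPlace k Λ p f (φ a) (φ b)).toValuationSubring.valuation_le_one_iff _).2 (polyEval_mem_pointPlace φ hζ₀ hsep hb u)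

omit hp [IsAlgClosed Λ] hζ₀ hsep in
/-- **Taylor expansion at a point**: `u - u(a, b) = (Y - b) q₁ + (X - a) q₂` in `R[X][Y]`. [folklore] -/
theorem exists_sub_C_C_evalEval_eq (u : R[X][Y]) (a b : R) :
    ∃ q₁ q₂ : R[X][Y], u - C (C (u.evalEval a b)) = (X - C (C b)) * q₁ + C (X - C a) * q₂ := by
  obtain ⟨q₁, hq₁⟩ := X_sub_C_dvd_sub_C_eval (p := u) (a := C b)
  obtain ⟨q₂, hq₂⟩ := X_sub_C_dvd_sub_C_eval (p := u.eval (C b)) (a := a)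
  refine ⟨q₁, C q₂, ?_⟩
  rw [← map_mul, ← hq₂, map_sub, ← hq₁, evalEval]
  ring

/-- **`u(x, y) ≡ u(a, b) (mod Q_{(a,b)})`**: the value of `u(x,y)` at the place of the point `(φ a, φ b)` is
`φ (u(a, b))`. [folklore] -/
theorem valuation_polyEval_sub_lt_one {a b : R} (hb : φ b ^ p = (f.map (algebraMap k Λ)).eval (φ a)) (u : R[X][Y]) :
    (pointPlace k Λ p f (φ a) (φ b)).valuation
      (polyEval k p f φ u - algebraMap Λ _ (φ (u.evalEval a b))) < 1 := by
  set Q := pointPlace k Λ p f (φ a) (φ b) with hQ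
  obtain ⟨q₁, q₂, h⟩ := exists_sub_C_C_evalEval_eq u a b
  have h1 : polyEval k p f φ u - algebraMap Λ _ (φ (u.evalEval a b)) =
      (genY k Λ p f - algebraMap Λ _ (φ b)) * polyEval k p f φ q₁ +
        (genX k Λ p f - algebraMap Λ _ (φ a)) * polyEval k p f φ q₂ := by
    rw [← polyEval_C_C φ, ← map_sub, h, map_add, map_mul, map_mul, map_sub, polyEval_X, polyEval_C_C,
      polyEval_C_X_sub_C]
  rw [h1]
  refine Valuation.map_add_lt _ ?_ ?_
  · rw [Valuation.map_mul]
    exact mul_lt_one_of_lt_of_le (valuation_pointPlace_genY_sub_lt_one hζ₀ hsep hb)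
      (valuation_polyEval_le_one φ hζ₀ hsep hb q₁)
  · rw [Valuation.map_mul]
    exact mul_lt_one_of_lt_of_le (valuation_pointPlace_genX_sub_lt_one hζ₀ hsep hb)
      (valuation_polyEval_le_one φ hζ₀ hsep hb q₂)

/-- **`u(x,y)` vanishes at `Q_{(a,b)}` iff `u(a, b) = 0`** (in `Λ`). [folklore] -/
theorem valuation_polyEval_lt_one_iff {a b : R} (hb : φ b ^ p = (f.map (algebraMap k Λ)).eval (φ a)) (u : R[X][Y]) :
    (pointPlace k Λ p f (φ a) (φ b)).valuation (polyEval k p f φ u) < 1 ↔ φ (u.evalEval a b) = 0 := by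
  set Q := pointPlace k Λ p f (φ a) (φ b) with hQ
  have h := valuation_polyEval_sub_lt_one φ hζ₀ hsep hb u
  constructor
  · intro hlt
    by_contra hne
    have h2 : Q.valuation ((polyEval k p f φ u) - (polyEval k p f φ u - algebraMap Λ _ (φ (u.evalEval a b)))) < 1 :=
      lt_of_le_of_lt (Valuation.map_sub _ _ _) (max_lt hlt h)
    rw [sub_sub_cancel, PlaceOver.valuation_algebraMap_eq_one Q hne] at h2
    exact lt_irrefl _ h2
  · intro h0
    rw [h0, map_zero, sub_zero] at h
    exact h

/-- **`v_{Q_{(a,b)}}(u(x,y)) = 0` iff `u(a, b) ≠ 0`.** [folklore] -/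
theorem ord_polyEval_eq_zero_iff {a b : R} (hb : φ b ^ p = (f.map (algebraMap k Λ)).eval (φ a)) {u : R[X][Y]}
    (hu : polyEval k p f φ u ≠ 0) :
    (pointPlace k Λ p f (φ a) (φ b)).ord (polyEval k p f φ u) = 0 ↔ φ (u.evalEval a b) ≠ 0 := by
  set Q := pointPlace k Λ p f (φ a) (φ b) with hQ
  rw [Ne, ← valuation_polyEval_lt_one_iff φ hζ₀ hsep hb, Q.valuation_lt_one_iff_ord_pos hu, not_lt]
  have h0 : 0 ≤ Q.ord (polyEval k p f φ u) :=
    (Q.mem_toValuationSubring_iff_ord_nonneg hu).1 (polyEval_mem_pointPlace φ hζ₀ hsep hb u)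
  omega

/-- `0 < v_{Q_{(a,b)}}(u(x,y))` iff `u(a, b) = 0` (for `u(x,y) ≠ 0`). [folklore] -/
theorem ord_polyEval_pos_iff {a b : R} (hb : φ b ^ p = (f.map (algebraMap k Λ)).eval (φ a)) {u : R[X][Y]}
    (hu : polyEval k p f φ u ≠ 0) :
    0 < (pointPlace k Λ p f (φ a) (φ b)).ord (polyEval k p f φ u) ↔ φ (u.evalEval a b) = 0 := by
  rw [← (pointPlace k Λ p f (φ a) (φ b)).valuation_lt_one_iff_ord_pos hu, valuation_polyEval_lt_one_iff φ hζ₀ hsep hb]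

/-- `0 ≤ v_{Q_{(a,b)}}(u(x,y))`. [folklore] -/
theorem ord_polyEval_nonneg {a b : R} (hb : φ b ^ p = (f.map (algebraMap k Λ)).eval (φ a)) {u : R[X][Y]}
    (hu : polyEval k p f φ u ≠ 0) : 0 ≤ (pointPlace k Λ p f (φ a) (φ b)).ord (polyEval k p f φ u) :=
  ((pointPlace k Λ p f (φ a) (φ b)).mem_toValuationSubring_iff_ord_nonneg hu).1
    (polyEval_mem_pointPlace φ hζ₀ hsep hb u)

end Values

/-! ### The division lemma -/

omit [Fact (Irreducible (superellipticPoly k Λ p f))] in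
/-- **Division lemma.**  If `u(a, b) = 0` and `b^p = f_R(a)`, then
`u · E_b = (X - a) · u' + (Y^p - f_R) · q` with `E_b = ∑_{i<p} Y^i b^{p-1-i}` (`(Y - b) E_b = Y^p - b^p`):
`u = u(X, b) + (Y - b) q₁`, `u(X, b) = (X - a) w₁`, and `Y^p - b^p = (Y^p - f_R) + (X - a) D` with
`f_R - f_R(a) = (X - a) D`.  (This is the algebra behind "a function vanishing at a smooth point of the special fibre
of `y^p = f(x)` is divisible by the local parameter `x - a`".) [folklore] -/
theorem exists_mul_geomSum_eq {u : R[X][Y]} {a b : R} {fR : R[X]} (hv : u.evalEval a b = 0) (hb : b ^ p = fR.eval a) :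
    ∃ u' q : R[X][Y], u * (∑ i ∈ Finset.range p, (X : R[X][Y]) ^ i * C (C b) ^ (p - 1 - i)) =
      C (X - C a) * u' + ((X : R[X][Y]) ^ p - C fR) * q := by
  set E : R[X][Y] := ∑ i ∈ Finset.range p, (X : R[X][Y]) ^ i * C (C b) ^ (p - 1 - i) with hE
  obtain ⟨q₁, hq₁⟩ := X_sub_C_dvd_sub_C_eval (p := u) (a := C b)
  have hw : (u.eval (C b)).IsRoot a := hv
  obtain ⟨w₁, hw₁⟩ : ∃ w₁ : R[X], u.eval (C b) = (X - C a) * w₁ :=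
    ⟨u.eval (C b) /ₘ (X - C a), (mul_divByMonic_eq_iff_isRoot.2 hw).symm⟩
  obtain ⟨D, hD⟩ := X_sub_C_dvd_sub_C_eval (p := fR) (a := a)
  have hEmul : E * (X - C (C b)) = (X : R[X][Y]) ^ p - C (C b) ^ p := geom_sum₂_mul _ _ _
  refine ⟨C w₁ * E + C D * q₁, q₁, ?_⟩
  have hu : u = C (X - C a) * C w₁ + (X - C (C b)) * q₁ := by rw [← map_mul, ← hw₁, ← hq₁]; ring
  have hbp : C (C b) ^ p = C fR - C (X - C a) * C D := by
    rw [← map_pow, ← map_pow, hb, ← map_mul, ← hD, ← map_sub, sub_sub_cancel]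
  linear_combination E * hu + q₁ * hEmul - q₁ * hbp

omit [Fact (Irreducible (superellipticPoly k Λ p f))] in
/-- The value of `E_b = ∑_{i<p} Y^i b^{p-1-i}` at a point `(a', b)` with the same `y`-coordinate is `p b^{p-1}`.
[folklore] -/
theorem evalEval_geomSum (a' b : R) :
    (∑ i ∈ Finset.range p, (X : R[X][Y]) ^ i * C (C b) ^ (p - 1 - i)).evalEval a' b = p * b ^ (p - 1) := by
  rw [evalEval]
  simp only [eval_finsetSum, eval_mul, eval_pow, eval_X, eval_C]
  have : ∀ i ∈ Finset.range p, b ^ i * b ^ (p - 1 - i) = b ^ (p - 1) := fun i hi => by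
    rw [← pow_add]; congr 1; have := Finset.mem_range.1 hi; omega
  rw [Finset.sum_congr rfl this, Finset.sum_const, Finset.card_range, nsmul_eq_mul]

/-! ### Norms of `u(x, y)` down to `Λ(x)` -/

section Norm

variable {fR : R[X]} (hf : fR.map φ = f.map (algebraMap k Λ))

variable (p) in
omit [Fact (Irreducible (superellipticPoly k Λ p f))] in
/-- **The norm form of the model**: `Nm(u) = N_{R[X][Y]/(Y^p - f_R) / R[X]}(u) ∈ R[X]`, the norm of `u` in the
free rank-`p` algebra `R[X][Y]/(Y^p - f_R)` over `R[X]` (a polynomial in the coefficients of `u`). [folklore] -/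
def modelNorm (fR : R[X]) (u : R[X][Y]) : R[X] :=
  Algebra.norm R[X] (AdjoinRoot.mk ((X : R[X][Y]) ^ p - C fR) u)

include hf in
/-- **The norm form computes the norm in `Λ(C_f)/Λ(x)`**: `N_{Λ(C_f)/Λ(x)}(u(x,y)) = Nm(u)^φ(x)` (the map
`R[X][Y]/(Y^p - f_R) → Λ(C_f)` over `R[X] → Λ(x)` matches the power bases `Y^i ↦ y^i`). [folklore] -/
theorem norm_polyEval (hp : p ≠ 0) (u : R[X][Y]) :
    Algebra.norm (RatFunc Λ) (polyEval k p f φ u) = coeffHom φ (modelNorm p fR u) := by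
  set g : R[X][Y] := (X : R[X][Y]) ^ p - C fR with hg
  have hgm : g.Monic := monic_X_pow_sub_C _ hp
  rcases subsingleton_or_nontrivial R with hR | hR
  · rw [Subsingleton.elim u 0, map_zero, Algebra.norm_zero, Subsingleton.elim (modelNorm p fR 0) 0, map_zero]
  -- the map `R[X][Y]/(g) → Λ(C_f)`
  set i₀ : R[X] →+* SuperellipticFunctionField k Λ p f := (algebraMap (RatFunc Λ) _).comp (coeffHom φ) with hi₀
  have hroot : g.eval₂ i₀ (genY k Λ p f) = 0 := by
    have h := polyEval_model (k := k) (p := p) (f := f) φ hf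
    rw [polyEval_apply, ← AdjoinRoot.aeval_eq, aeval_def, eval₂_map] at h
    exact h
  set ψ : AdjoinRoot g →+* SuperellipticFunctionField k Λ p f := AdjoinRoot.lift i₀ (genY k Λ p f) hroot with hψ
  have hψmk : ∀ v : R[X][Y], ψ (AdjoinRoot.mk g v) = polyEval k p f φ v := fun v => by
    rw [hψ, AdjoinRoot.lift_mk, polyEval_apply, ← AdjoinRoot.aeval_eq, aeval_def, eval₂_map]; rfl
  -- the two power bases `Y^i` and `y^i`
  have hirr : Irreducible (superellipticPoly k Λ p f) := Fact.out
  have hdim : (AdjoinRoot.powerBasis' hgm).dim = (AdjoinRoot.powerBasis hirr.ne_zero).dim := by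
    change g.natDegree = (superellipticPoly k Λ p f).natDegree
    rw [hg, natDegree_X_pow_sub_C, natDegree_superellipticPoly]
  let e : Fin (AdjoinRoot.powerBasis' hgm).dim ≃ Fin (AdjoinRoot.powerBasis hirr.ne_zero).dim := finCongr hdim
  have hb : ∀ i, ψ ((AdjoinRoot.powerBasis' hgm).basis i) =
      ((AdjoinRoot.powerBasis hirr.ne_zero).basis.reindex e.symm) i := fun i => by
    rw [Module.Basis.reindex_apply, Equiv.symm_symm, PowerBasis.coe_basis, PowerBasis.coe_basis]
    simp only [AdjoinRoot.powerBasis'_gen, AdjoinRoot.powerBasis_gen, map_pow, e, finCongr_apply, Fin.val_cast]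
    rw [hψ, AdjoinRoot.lift_root]
    rfl
  have halg : ∀ r : R[X], ψ (algebraMap R[X] (AdjoinRoot g) r) = algebraMap (RatFunc Λ) _ (coeffHom φ r) := fun r => by
    rw [AdjoinRoot.algebraMap_eq, hψ, AdjoinRoot.lift_of]; rfl
  rw [← hψmk, modelNorm, ← hg]
  exact (norm_map_of_basis (AdjoinRoot.powerBasis' hgm).basis ((AdjoinRoot.powerBasis hirr.ne_zero).basis.reindex e.symm)
    (coeffHom φ) ψ halg hb _).symm

end Norm

/-! ### Orders at the places of `Λ(x)` and fibre sums of orders -/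

section FibreSum

variable [hp : Fact p.Prime]

omit [Fact (Irreducible (superellipticPoly k Λ p f))] hp in
/-- **`v_{P_a}(g) = mult_a(g)`** for a nonzero polynomial `g ∈ Λ[X]`. [cite: Stichtenoth2009, Prop. 1.2.1] -/
theorem ord_placeXSubC_algebraMap_eq_rootMultiplicity {g : Λ[X]} (hg : g ≠ 0) (a : Λ) :
    (placeXSubC a).ord (algebraMap Λ[X] (RatFunc Λ) g) = g.rootMultiplicity a := by
  obtain ⟨q, hq, hdvd⟩ := exists_eq_pow_rootMultiplicity_mul_and_not_dvd g hg a
  have hqa : q.eval a ≠ 0 := fun h => hdvd (dvd_iff_isRoot.2 h)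
  have hq0 : q ≠ 0 := by rintro rfl; exact hqa eval_zero
  have hXa : algebraMap Λ[X] (RatFunc Λ) ((X - C a) ^ g.rootMultiplicity a) ≠ 0 :=
    (map_ne_zero_iff _ (IsFractionRing.injective Λ[X] (RatFunc Λ))).2 (pow_ne_zero _ (X_sub_C_ne_zero a))
  have hq' : algebraMap Λ[X] (RatFunc Λ) q ≠ 0 := (map_ne_zero_iff _ (IsFractionRing.injective Λ[X] (RatFunc Λ))).2 hq0
  conv_lhs => rw [hq]
  rw [map_mul, (placeXSubC a).ord_mul_eq hXa hq', ord_placeXSubC_algebraMap_of_eval_ne_zero a hqa, add_zero, map_pow,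
    (placeXSubC a).ord_pow ((map_ne_zero_iff _ (IsFractionRing.injective Λ[X] (RatFunc Λ))).2 (X_sub_C_ne_zero a)),
    map_sub, RatFunc.algebraMap_X, RatFunc.algebraMap_C, ord_placeXSubC_X_sub_C, mul_one]

variable [IsAlgClosed Λ] {ζ₀ : Λ} (hζ₀ : IsPrimitiveRoot ζ₀ p) (hsep : f.Separable)
include hζ₀ hsep

omit hp [IsAlgClosed Λ] hζ₀ hsep in
/-- `v_Q(∏ z_i) = ∑ v_Q(z_i)` for nonzero factors. [folklore] -/
theorem ord_prod {ι : Type*} (Q : PlaceOver Λ (SuperellipticFunctionField k Λ p f)) (s : Finset ι)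
    (z : ι → SuperellipticFunctionField k Λ p f) (hz : ∀ i ∈ s, z i ≠ 0) :
    Q.ord (∏ i ∈ s, z i) = ∑ i ∈ s, Q.ord (z i) := by
  induction s using Finset.induction_on with
  | empty => simp [Q.ord_one]
  | insert i s hi ih =>
    rw [Finset.prod_insert hi, Finset.sum_insert hi,
      Q.ord_mul_eq (hz i (Finset.mem_insert_self i s)) (Finset.prod_ne_zero_iff.2 fun j hj => hz j (Finset.mem_insert_of_mem hj)),
      ih fun j hj => hz j (Finset.mem_insert_of_mem hj)]

/-- **Fibre sum of orders = order of the norm**: `∑_{Q | P_a} v_Q(z) = v_{P_a}(N_{Λ(C_f)/Λ(x)}(z))` for `z ≠ 0`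
(`N(z) = ∏ δ^i z`; above a non-root the `p` places are `δ^{-i} Q₀` with `e = 1`, above a root there is one place with
`e = p`). [cite: Stichtenoth2009, Thm. 3.1.11] -/
theorem sum_ord_fibre_eq_ord_norm {z : SuperellipticFunctionField k Λ p f} (hz : z ≠ 0) (a : Λ) :
    ∑ Q ∈ ((placeXSubC a).finite_setOf_restrict_eq (F' := SuperellipticFunctionField k Λ p f)).toFinset, Q.ord z =
      (placeXSubC a).ord (Algebra.norm (RatFunc Λ) z) := by
  haveI : NeZero p := ⟨hp.out.ne_zero⟩
  have hf0 : f ≠ 0 := hsep.ne_zero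
  set δ := CyclicCoverDeck.ofRoot hζ₀.pow_eq_one with hδ
  set S := ((placeXSubC a).finite_setOf_restrict_eq (F' := SuperellipticFunctionField k Λ p f)).toFinset with hS
  have hmemS : ∀ Q, Q ∈ S ↔ Q.restrict (K := Λ) (F := RatFunc Λ) = placeXSubC a := fun Q =>
    (placeXSubC a).mem_toFinset_restrict_eq_iff Q
  have hN := algebraMap_norm_eq_prod_deck_pow_smul (K := k) hζ₀ hf0 z
  -- the order of `∏ δ^i z` at a place `Q₀` of the fibre
  have hordN : ∀ Q₀ : PlaceOver Λ (SuperellipticFunctionField k Λ p f),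
      Q₀.ord (algebraMap (RatFunc Λ) _ (Algebra.norm (RatFunc Λ) z)) = ∑ i ∈ Finset.range p, ((δ ^ i)⁻¹ • Q₀).ord z := by
    intro Q₀
    rw [hN, ord_prod Q₀ _ _ fun i _ => (smul_ne_zero_iff_ne _).2 hz]
    refine Finset.sum_congr rfl fun i _ => ?_
    conv_lhs => rw [show Q₀ = (δ ^ i) • ((δ ^ i)⁻¹ • Q₀) by rw [smul_inv_smul]]
    exact PlaceOver.ord_smul_smul (δ ^ i) _ z
  by_cases hβ : (f.map (algebraMap k Λ)).eval a = 0
  · -- above a root: one place `T_a`, `e = p`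
    have hSeq : S = {rootPlace k Λ p f a} := by
      ext Q
      rw [hmemS, Finset.mem_singleton]
      exact ⟨fun h => eq_rootPlace_of_restrict_eq hsep hβ h, fun h => h ▸ restrict_rootPlace a⟩
    rw [hSeq, Finset.sum_singleton]
    have h1 := hordN (rootPlace k Λ p f a)
    rw [ord_algebraMap_ratFunc, restrict_rootPlace, ramificationIdx_rootPlace hsep hβ] at h1
    have h2 : ∑ i ∈ Finset.range p, ((δ ^ i)⁻¹ • rootPlace k Λ p f a).ord z = p * (rootPlace k Λ p f a).ord z := by
      rw [Finset.sum_congr rfl fun i _ => by rw [← inv_pow, deck_smul_rootPlace hsep hβ], Finset.sum_const,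
        Finset.card_range, nsmul_eq_mul]
    rw [h2] at h1
    have hp0 : (p : ℤ) ≠ 0 := by exact_mod_cast hp.out.ne_zero
    exact (mul_left_cancel₀ hp0 h1).symm
  · -- above a non-root: `p` places `δ^{-i} Q₀`, `e = 1`
    obtain ⟨Q₀, hQ₀⟩ := PlaceOver.exists_restrict_eq' (K := Λ) (F := RatFunc Λ)
      (F' := SuperellipticFunctionField k Λ p f) (placeXSubC a)
    have h1 := hordN Q₀
    rw [ord_algebraMap_ratFunc, hQ₀, ramificationIdx_eq_one_of_eval_ne_zero hζ₀ hβ hQ₀, one_mul] at h1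
    rw [h1]
    -- reindex the fibre by `i ↦ δ^{-i} Q₀`
    have hcard : S.card = p := card_fibre_of_eval_ne_zero hζ₀ hβ
    let q : ℕ → PlaceOver Λ (SuperellipticFunctionField k Λ p f) := fun i => (δ ^ i)⁻¹ • Q₀
    have hqS : ∀ i, q i ∈ S := fun i => (hmemS _).2 (by
      change ((δ ^ i)⁻¹ • Q₀).restrict (K := Λ) (F := RatFunc Λ) = placeXSubC a
      rw [restrict_deck_smul, hQ₀])
    have hsurj : ∀ Q ∈ S, ∃ i ∈ Finset.range p, q i = Q := by
      intro Q hQ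
      obtain ⟨ζ, hζ⟩ := exists_deck_smul_eq_of_eval_ne_zero hζ₀ hβ hQ₀ ((hmemS Q).1 hQ)
      obtain ⟨i, hi, hζi⟩ := CyclicCoverDeck.exists_eq_ofRoot_pow hζ₀ ζ⁻¹
      refine ⟨i, Finset.mem_range.2 hi, ?_⟩
      change ((δ ^ i)⁻¹ • Q₀) = Q
      rw [← hδ] at hζi
      rw [← hζi, inv_inv, hζ]
    have himage : (Finset.range p).image q = S := by
      refine Finset.Subset.antisymm (Finset.image_subset_iff.2 fun i _ => hqS i) fun Q hQ => ?_
      obtain ⟨i, hi, rfl⟩ := hsurj Q hQ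
      exact Finset.mem_image_of_mem q hi
    have hinj : Set.InjOn q (Finset.range p) :=
      Finset.card_image_iff.1 (by rw [himage, hcard, Finset.card_range])
    rw [← himage, Finset.sum_image hinj]

end FibreSum

end SuperellipticFunctionField

end Literature.NumberTheory.GaloisRepresentations
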